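import Literature.Analysis.FluidPDE.SelfSimilarCollapseAnsatz
import Literature.Analysis.FluidPDE.CurlFreeLiouville
import Literature.Analysis.FluidPDE.PoincareHomotopyOperator
import HarnessLib

/-!
# Viscous rigidity of the LOCAL velocity-only self-similar ansatz (arbitrary pressure)

Summit `NavierStokesRegularity`, cell topic directory `FluidComputer`, namespace
`…FluidComputer.SelfSimilarCensus` (kernel side of the `ns-blowup` cell's self-similar census
`selfsim/SELFSIM-NOGO.md`, row (M16-L)); companions: `SelfSimilarCollapseViscousRigidity.lean`
(local ansatz for the PAIR `(u, p)`), `VelocityCovarianceViscousRigidity.lean` (velocity-only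
covariance, global Liouville endgame). This file treats the census ansatz (M1) exactly as stated:
ONLY the velocity is self-similar, `u(t, x) = (T − t)^{γ−1} U((T − t)^{−γ} x)` for `T − δ < t < T`,
`‖x‖ < r`, with SOME pressure (`C²` slices). PROVED theorems only; no data, no named facts.

## The argument

Fix `y ∈ ℝ³` and a time `t` close enough to `T` that `x = (T−t)^γ y` lies in `B(0, r)`. By the
tree's identity `ns_momentum_selfSimilarCollapse` (pressure ansatz `0`), the momentum equation at
`(t, x)` reads `∇p(t)(x) = −(T−t)^{γ−2} [E(y) − ν(T−t)^{1−2γ} ΔU(y)]`,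
`E := (1−γ)U + DU(γy + U)`; for the RESCALED pressure `Q_t(z) := p(t, (T−t)^γ z)` this is
`(T−t)^{2−2γ} ∇Q_t(y) = −E(y) + ν(T−t)^{1−2γ} ΔU(y)` (`rescaledPressure_gradient_eq`). Two slices
`t₁ ≠ t₂` (γ ≠ ½ ⇒ different effective viscosities) give, on a whole ball of `y`'s,
`ΔU = ∇Ψ` with an explicit `C²` potential `Ψ`, hence `curl ΔU = 0`, hence (`curl Δ = Δ curl`, tree
`curl_laplacian`) **the vorticity profile `curl U` is harmonic on all of `ℝ³`**
(`laplacian_curl_profile_eq_zero`). With `curl U` bounded it is constant (`Ω₀`), `U − ½Ω₀ × y` is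
curl- and divergence-free hence harmonic, so a bounded divergence-free profile is CONSTANT
(`profile_eq_const_of_ns_selfSimilar_velocity`): the exact velocity-only ansatz with `γ ∈ (0,∞)∖{½}`
carries no strain and no vorticity, for ANY pressure. No symmetry class, no energy hypothesis.

## WHAT THIS IS NOT

Not a statement about `γ = ½` (Leray; Tsai / Nečas–Růžička–Šverák), not about asymptotically
self-similar blow-up, not a regularity theorem.

## Tree / Mathlib tools

`ns_momentum_selfSimilarCollapse`, `gradient_comp_smul`, `curl_gradient_eq_zero_holds`,
`curl_laplacian`, `contDiff_curl`, `curl_sub`, `curlCLM_crossCLM`, `trace_eq_sum_coord`,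
`laplacian_eq_zero_of_curl_eq_zero_of_isDivFree`, `laplacian_eq_sum_fderiv_fderiv`,
`harmonicOnNhd_of_laplacian_eq_zero`, `InnerProductSpace.HarmonicOnNhd.apply_eq_apply_of_abs_le`;
Mathlib `Filter.EventuallyEq.fderiv_eq`, `Real.rpow_rpow_inv`, `ContDiffAt.laplacian_add`.

## References

* J. Leray, Acta Math. 63 (1934), (3.11)–(3.12). [Leray1934]
* J. Nečas, M. Růžička, V. Šverák, Acta Math. 176 (1996), Introduction. [NecasRuzickaSverak1996]
* A. J. Majda, A. L. Bertozzi, *Vorticity and Incompressible Flow* (CUP 2002), §1.2, §2.4.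
  [MajdaBertozziCUP2002]
-/

noncomputable section

open Set Filter Topology InnerProductSpace Metric
open scoped Laplacian RealInnerProductSpace

namespace Summit.NavierStokesRegularity.FluidComputer.SelfSimilarCensus

open Literature.Analysis.FluidPDE

section VelocityOnlyAnsatz

variable {γ T ν δ r t : ℝ}
  {U : EuclideanSpace ℝ (Fin 3) → EuclideanSpace ℝ (Fin 3)} {p : ℝ → EuclideanSpace ℝ (Fin 3) → ℝ}

/-- **Pressure-free momentum identity on the ansatz.** For `U ∈ C¹`, `t < T`, any `ν`:
`∂ₜu + (u·∇)u − νΔu = (T−t)^{γ−2} • [(1−γ)U(y) + DU(y)(γy + U(y)) − ν_eff(t) ΔU(y)]`, `y = (T−t)^{−γ}x`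
(the tree's `ns_momentum_selfSimilarCollapse` with the zero pressure profile). [folklore] -/
theorem ns_momentum_selfSimilarCollapse_noPressure (ht : t < T) (hU : ContDiff ℝ 1 U) (ν : ℝ)
    (x : EuclideanSpace ℝ (Fin 3)) :
    timeDeriv (selfSimilarCollapse γ T U) t x +
        convect (selfSimilarCollapse γ T U t) (selfSimilarCollapse γ T U t) x -
        ν • (Δ (selfSimilarCollapse γ T U t)) x =
      (T - t) ^ (γ - 2) •
        ((1 - γ) • U ((T - t) ^ (-γ) • x) +
          fderiv ℝ U ((T - t) ^ (-γ) • x) (γ • ((T - t) ^ (-γ) • x) + U ((T - t) ^ (-γ) • x)) -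
          effectiveViscosity ν γ T t • (Δ U) ((T - t) ^ (-γ) • x)) := by
  have h := ns_momentum_selfSimilarCollapse (γ := γ) (T := T) (P := fun _ => (0 : ℝ)) ht hU ν x
  have h0 : selfSimilarCollapsePressure γ T (fun _ : EuclideanSpace ℝ (Fin 3) => (0 : ℝ)) t =
      fun _ => 0 := by
    funext z; simp [selfSimilarCollapsePressure_apply]
  have hg0 : gradient (fun _ : EuclideanSpace ℝ (Fin 3) => (0 : ℝ)) = fun _ => 0 := by
    funext z; simp [gradient]
  rw [h0, hg0] at h
  simpa using h

/-- **Rescaled pressure gradient.** If, in addition, the momentum equation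
`∂ₜu + (u·∇)u + ∇p(t) − νΔu = 0` holds at `(t, x)` with `x = (T−t)^γ y ∈ B(0, r)` for SOME pressure
slice `p(t, ·)`, then the rescaled pressure `Q_t(z) := p(t, (T−t)^γ z)` satisfies
`(T−t)^{2−2γ} ∇Q_t(y) = −[(1−γ)U(y) + DU(y)(γy + U(y))] + ν(T−t)^{1−2γ} ΔU(y)`. [folklore] -/
theorem rescaledPressure_gradient_eq (ht : t < T) (hU : ContDiff ℝ 1 U) {y : EuclideanSpace ℝ (Fin 3)}
    (hNS : timeDeriv (selfSimilarCollapse γ T U) t ((T - t) ^ γ • y) +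
        convect (selfSimilarCollapse γ T U t) (selfSimilarCollapse γ T U t) ((T - t) ^ γ • y) +
        gradient (p t) ((T - t) ^ γ • y) -
        ν • (Δ (selfSimilarCollapse γ T U t)) ((T - t) ^ γ • y) = 0) :
    (T - t) ^ (2 - 2 * γ) • gradient (fun z => p t ((T - t) ^ γ • z)) y =
      -((1 - γ) • U y + fderiv ℝ U y (γ • y + U y)) + effectiveViscosity ν γ T t • (Δ U) y := by
  have hpos : 0 < T - t := sub_pos.mpr ht
  have hback : (T - t) ^ (-γ) • ((T - t) ^ γ • y) = y := by
    rw [smul_smul, ← Real.rpow_add hpos, neg_add_cancel, Real.rpow_zero, one_smul]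
  have hm := ns_momentum_selfSimilarCollapse_noPressure (γ := γ) (T := T) ht hU ν ((T - t) ^ γ • y)
  rw [hback] at hm
  -- ∇p(t)(x) = -(momentum without pressure)
  have hgrad : gradient (p t) ((T - t) ^ γ • y) =
      -((T - t) ^ (γ - 2) • ((1 - γ) • U y + fderiv ℝ U y (γ • y + U y) -
        effectiveViscosity ν γ T t • (Δ U) y)) := by
    rw [← hm]
    have e : timeDeriv (selfSimilarCollapse γ T U) t ((T - t) ^ γ • y) +
        convect (selfSimilarCollapse γ T U t) (selfSimilarCollapse γ T U t) ((T - t) ^ γ • y) -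
        ν • (Δ (selfSimilarCollapse γ T U t)) ((T - t) ^ γ • y) =
        -gradient (p t) ((T - t) ^ γ • y) := by
      rw [eq_neg_iff_add_eq_zero, ← hNS]; abel
    rw [e, neg_neg]
  have h1 : (T - t) ^ (2 - 2 * γ) * (T - t) ^ γ * (T - t) ^ (γ - 2) = 1 := by
    rw [← Real.rpow_add hpos, ← Real.rpow_add hpos, show 2 - 2 * γ + γ + (γ - 2) = (0 : ℝ) by ring,
      Real.rpow_zero]
  rw [gradient_comp_smul, hgrad, smul_neg, smul_neg, smul_smul, smul_smul, h1, one_smul]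
  abel

/-- **Harmonic vorticity profile.** Let `γ > 0`, `γ ≠ ½`, `ν ≠ 0`, `δ, r > 0`, `U ∈ C³`, and let
the pressure slices `p(t, ·)` be `C²`. If the velocity ansatz `u = selfSimilarCollapse γ T U`
together with the pressure `p` satisfies the Navier–Stokes momentum equation pointwise on
`{T−δ < t < T} × B(0, r)`, then the vorticity profile is harmonic on all of `ℝ³`:
`Δ(curl U)(y) = 0` for every `y`. (Two slices make `ΔU` a gradient on a ball around `y`; `curl ∘ ∇ = 0`;
`curl Δ = Δ curl`.) [folklore] -/
theorem laplacian_curl_profile_eq_zero (hγ0 : 0 < γ) (hγ : γ ≠ 1 / 2) (hν : ν ≠ 0)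
    (hδ : 0 < δ) (hr : 0 < r) (hU : ContDiff ℝ 3 U) (hp : ∀ t ∈ Ioo (T - δ) T, ContDiff ℝ 2 (p t))
    (hNS : ∀ t ∈ Ioo (T - δ) T, ∀ x ∈ ball (0 : EuclideanSpace ℝ (Fin 3)) r,
      timeDeriv (selfSimilarCollapse γ T U) t x +
        convect (selfSimilarCollapse γ T U t) (selfSimilarCollapse γ T U t) x +
        gradient (p t) x - ν • (Δ (selfSimilarCollapse γ T U t)) x = 0)
    (y : EuclideanSpace ℝ (Fin 3)) : (Δ (curl U)) y = 0 := by
  have hU1 : ContDiff ℝ 1 U := hU.of_le (by norm_num)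
  -- two time slices whose scaled copies of the ball B(y, 1) ⊂ B(0, ‖y‖+1) fit into B(0, r)
  set R : ℝ := ‖y‖ + 1 with hR
  have hRpos : 0 < R := by positivity
  have h1 : Tendsto (fun t : ℝ => T - t) (𝓝[<] T) (𝓝 0) := by
    have : Tendsto (fun t : ℝ => T - t) (𝓝 T) (𝓝 (T - T)) :=
      (continuous_const.sub continuous_id).tendsto T
    rw [sub_self] at this
    exact this.mono_left nhdsWithin_le_nhds
  have h3 : Tendsto (fun t : ℝ => (T - t) ^ γ * R) (𝓝[<] T) (𝓝 0) := by
    have h2 : ContinuousAt (fun s : ℝ => s ^ γ) 0 := Real.continuousAt_rpow_const 0 _ (Or.inr hγ0.le)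
    have := (h2.tendsto.comp h1).mul_const R
    rwa [Function.comp_def, Real.zero_rpow hγ0.ne', zero_mul] at this
  have hev : ∀ᶠ t in 𝓝[<] T, t ∈ Ioo (T - δ) T ∧ (T - t) ^ γ * R < r := by
    have hI : ∀ᶠ t in 𝓝[<] T, t ∈ Ioo (T - δ) T := Ioo_mem_nhdsLT (sub_lt_self T hδ)
    exact hI.and (h3.eventually (gt_mem_nhds hr))
  obtain ⟨t₁, ht₁I, ht₁B⟩ := hev.exists
  have ht₁T : t₁ < T := ht₁I.2
  have hJ : ∀ᶠ t in 𝓝[<] T, t ∈ Ioo t₁ T := Ioo_mem_nhdsLT ht₁T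
  obtain ⟨t₂, ⟨ht₂I, ht₂B⟩, ht₂J⟩ := (hev.and hJ).exists
  have ht₂T : t₂ < T := ht₂I.2
  have hne12 : t₁ ≠ t₂ := ne_of_lt ht₂J.1
  -- scaled points of B(0, R) lie in B(0, r)
  have hin : ∀ {s : ℝ}, s < T → (T - s) ^ γ * R < r → ∀ z ∈ ball (0 : EuclideanSpace ℝ (Fin 3)) R,
      (T - s) ^ γ • z ∈ ball (0 : EuclideanSpace ℝ (Fin 3)) r := by
    intro s hs hsB z hz
    rw [mem_ball_zero_iff] at hz ⊢
    rw [norm_smul, Real.norm_of_nonneg (Real.rpow_nonneg (sub_pos.mpr hs).le γ)]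
    calc (T - s) ^ γ * ‖z‖ ≤ (T - s) ^ γ * R :=
          mul_le_mul_of_nonneg_left hz.le (Real.rpow_nonneg (sub_pos.mpr hs).le γ)
      _ < r := hsB
  -- the effective viscosities differ
  have hvisc : effectiveViscosity ν γ T t₁ ≠ effectiveViscosity ν γ T t₂ := by
    rw [effectiveViscosity_apply, effectiveViscosity_apply]
    intro h
    have h' : (T - t₁) ^ (1 - 2 * γ) = (T - t₂) ^ (1 - 2 * γ) := mul_left_cancel₀ hν h
    have hexp : (1 - 2 * γ) ≠ 0 := by intro h0; exact hγ (by linarith)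
    have h'' : ((T - t₁) ^ (1 - 2 * γ)) ^ (1 - 2 * γ)⁻¹ =
        ((T - t₂) ^ (1 - 2 * γ)) ^ (1 - 2 * γ)⁻¹ := by rw [h']
    rw [Real.rpow_rpow_inv (sub_pos.mpr ht₁T).le hexp,
      Real.rpow_rpow_inv (sub_pos.mpr ht₂T).le hexp] at h''
    exact hne12 (by linarith)
  set c : ℝ := effectiveViscosity ν γ T t₁ - effectiveViscosity ν γ T t₂ with hc
  have hc0 : c ≠ 0 := sub_ne_zero.mpr hvisc
  -- the two rescaled pressures and the potential Ψ
  have hQ₁2 : ContDiff ℝ 2 (fun z : EuclideanSpace ℝ (Fin 3) => p t₁ ((T - t₁) ^ γ • z)) :=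
    (hp t₁ ht₁I).comp (contDiff_id.const_smul _)
  have hQ₂2 : ContDiff ℝ 2 (fun z : EuclideanSpace ℝ (Fin 3) => p t₂ ((T - t₂) ^ γ • z)) :=
    (hp t₂ ht₂I).comp (contDiff_id.const_smul _)
  have hΨ2 : ContDiff ℝ 2 (fun z : EuclideanSpace ℝ (Fin 3) =>
      c⁻¹ * ((T - t₁) ^ (2 - 2 * γ) * p t₁ ((T - t₁) ^ γ • z) -
        (T - t₂) ^ (2 - 2 * γ) * p t₂ ((T - t₂) ^ γ • z))) :=
    contDiff_const.mul ((contDiff_const.mul hQ₁2).sub (contDiff_const.mul hQ₂2))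
  -- ΔU = ∇Ψ on B(0, R)
  have hgradΨ : ∀ z ∈ ball (0 : EuclideanSpace ℝ (Fin 3)) R, (Δ U) z =
      gradient (fun w : EuclideanSpace ℝ (Fin 3) =>
        c⁻¹ * ((T - t₁) ^ (2 - 2 * γ) * p t₁ ((T - t₁) ^ γ • w) -
          (T - t₂) ^ (2 - 2 * γ) * p t₂ ((T - t₂) ^ γ • w))) z := by
    intro z hz
    have e1 := rescaledPressure_gradient_eq (γ := γ) (T := T) (ν := ν) (p := p) ht₁T hU1
      (hNS t₁ ht₁I _ (hin ht₁T ht₁B z hz))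
    have e2 := rescaledPressure_gradient_eq (γ := γ) (T := T) (ν := ν) (p := p) ht₂T hU1
      (hNS t₂ ht₂I _ (hin ht₂T ht₂B z hz))
    -- subtract: c • ΔU z = a₁ • ∇Q₁ z − a₂ • ∇Q₂ z
    have hsub : c • (Δ U) z =
        (T - t₁) ^ (2 - 2 * γ) • gradient (fun w => p t₁ ((T - t₁) ^ γ • w)) z -
        (T - t₂) ^ (2 - 2 * γ) • gradient (fun w => p t₂ ((T - t₂) ^ γ • w)) z := by
      rw [hc, sub_smul, e1, e2]; abel
    -- gradient of Ψ
    have hd1 : DifferentiableAt ℝ (fun w : EuclideanSpace ℝ (Fin 3) => p t₁ ((T - t₁) ^ γ • w)) z :=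
      (hQ₁2.differentiable (by norm_num)) z
    have hd2 : DifferentiableAt ℝ (fun w : EuclideanSpace ℝ (Fin 3) => p t₂ ((T - t₂) ^ γ • w)) z :=
      (hQ₂2.differentiable (by norm_num)) z
    have hH : HasFDerivAt
        (fun w : EuclideanSpace ℝ (Fin 3) => c⁻¹ * ((T - t₁) ^ (2 - 2 * γ) * p t₁ ((T - t₁) ^ γ • w) -
          (T - t₂) ^ (2 - 2 * γ) * p t₂ ((T - t₂) ^ γ • w)))
        (c⁻¹ • ((T - t₁) ^ (2 - 2 * γ) •
            fderiv ℝ (fun w : EuclideanSpace ℝ (Fin 3) => p t₁ ((T - t₁) ^ γ • w)) z -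
          (T - t₂) ^ (2 - 2 * γ) •
            fderiv ℝ (fun w : EuclideanSpace ℝ (Fin 3) => p t₂ ((T - t₂) ^ γ • w)) z)) z :=
      ((hd1.hasFDerivAt.const_mul _).sub (hd2.hasFDerivAt.const_mul _)).const_mul c⁻¹
    simp only [gradient] at hsub ⊢
    rw [hH.fderiv]
    simp only [map_smul, map_sub]
    rw [← hsub, smul_smul, inv_mul_cancel₀ hc0, one_smul]
  -- curl ΔU = 0 at y (ΔU agrees with ∇Ψ near y), then commute
  have hyR : y ∈ ball (0 : EuclideanSpace ℝ (Fin 3)) R := by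
    rw [mem_ball_zero_iff, hR]; linarith
  have hloc : Δ U =ᶠ[𝓝 y] gradient (fun w : EuclideanSpace ℝ (Fin 3) =>
      c⁻¹ * ((T - t₁) ^ (2 - 2 * γ) * p t₁ ((T - t₁) ^ γ • w) -
        (T - t₂) ^ (2 - 2 * γ) * p t₂ ((T - t₂) ^ γ • w))) := by
    filter_upwards [isOpen_ball.mem_nhds hyR] with z hz
    exact hgradΨ z hz
  have hcurl : curl (Δ U) y = 0 := by
    rw [curl_eq_curlCLM, hloc.fderiv_eq, ← curl_eq_curlCLM]
    exact curl_gradient_eq_zero_holds _ hΨ2 y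
  rw [← curl_laplacian hU y]
  exact hcurl

/-- **Velocity-only rigidity of the local self-similar ansatz (census (M1), any pressure).**
Let `γ > 0`, `γ ≠ ½`, `ν ≠ 0`, `δ, r > 0`; `U ∈ C³`, divergence free, bounded, with bounded curl; the
pressure slices `p(t, ·)` `C²`. If `u = (T−t)^{γ−1} U((T−t)^{−γ} x)` and `p` satisfy the Navier–Stokes
momentum equation pointwise on `{T−δ < t < T} × B(0, r)`, then the profile is CONSTANT:
`U(y) = U(0)` for all `y` (hence the ansatz has no strain and no vorticity near the singular
point). Proof: `curl U` is harmonic (`laplacian_curl_profile_eq_zero`) and bounded ⇒ constant `Ω₀`;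
`U − ½Ω₀ × y` is curl- and divergence-free ⇒ harmonic; `U` bounded harmonic ⇒ constant. [folklore] -/
theorem profile_eq_const_of_ns_selfSimilar_velocity (hγ0 : 0 < γ) (hγ : γ ≠ 1 / 2) (hν : ν ≠ 0)
    (hδ : 0 < δ) (hr : 0 < r) (hU : ContDiff ℝ 3 U) (hdiv : VectorCalculus.IsDivFree U)
    {M : ℝ} (hM : ∀ y, ‖U y‖ ≤ M) {Mω : ℝ} (hMω : ∀ y, ‖curl U y‖ ≤ Mω)
    (hp : ∀ t ∈ Ioo (T - δ) T, ContDiff ℝ 2 (p t))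
    (hNS : ∀ t ∈ Ioo (T - δ) T, ∀ x ∈ ball (0 : EuclideanSpace ℝ (Fin 3)) r,
      timeDeriv (selfSimilarCollapse γ T U) t x +
        convect (selfSimilarCollapse γ T U t) (selfSimilarCollapse γ T U t) x +
        gradient (p t) x - ν • (Δ (selfSimilarCollapse γ T U t)) x = 0)
    (y : EuclideanSpace ℝ (Fin 3)) : U y = U 0 := by
  -- Liouville for a bounded C² field with zero Laplacian (per coordinate)
  have liouville : ∀ {V : EuclideanSpace ℝ (Fin 3) → EuclideanSpace ℝ (Fin 3)}, ContDiff ℝ 2 V →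
      (∀ z, (Δ V) z = 0) → ∀ {B : ℝ}, (∀ z, ‖V z‖ ≤ B) → ∀ a b, V a = V b := by
    intro V hV hΔ B hB a b
    have hharm : HarmonicOnNhd V univ := harmonicOnNhd_of_laplacian_eq_zero hV hΔ
    apply ext_inner_left ℝ
    intro e
    have hcomp : HarmonicOnNhd (⇑(innerSL ℝ e) ∘ V) univ := hharm.comp_CLM (innerSL ℝ e)
    have hbdd : ∀ z, |(⇑(innerSL ℝ e) ∘ V) z| ≤ ‖e‖ * B := fun z => by
      rw [Function.comp_apply, innerSL_apply_apply ℝ]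
      exact (abs_real_inner_le_norm e (V z)).trans (mul_le_mul_of_nonneg_left (hB z) (norm_nonneg e))
    have := hcomp.apply_eq_apply_of_abs_le hbdd a b
    simpa [Function.comp_apply, innerSL_apply_apply ℝ] using this
  have hU2 : ContDiff ℝ 2 U := hU.of_le (by norm_num)
  -- constant vorticity profile
  have hω2 : ContDiff ℝ 2 (curl U) := contDiff_curl (n := 2) (by exact_mod_cast hU)
  have hΔω : ∀ z, (Δ (curl U)) z = 0 := fun z =>
    laplacian_curl_profile_eq_zero (T := T) (p := p) hγ0 hγ hν hδ hr hU hp hNS z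
  set Ω₀ : EuclideanSpace ℝ (Fin 3) := curl U 0 with hΩ₀
  have hω : ∀ z, curl U z = Ω₀ := fun z => liouville hω2 hΔω hMω z 0
  -- subtract the solid-body rotation L z = ½ Ω₀ × z
  set L : EuclideanSpace ℝ (Fin 3) →L[ℝ] EuclideanSpace ℝ (Fin 3) := (1 / 2 : ℝ) • crossCLM Ω₀
    with hL
  have hcurlL : ∀ z, curl (⇑L) z = Ω₀ := fun z => by
    rw [curl_eq_curlCLM, ContinuousLinearMap.fderiv, hL, map_smul, curlCLM_crossCLM, smul_smul]
    norm_num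
  have hdivL : ∀ z, VectorCalculus.divergence (⇑L) z = 0 := fun z => by
    rw [VectorCalculus.divergence, ContinuousLinearMap.fderiv, hL,
      ContinuousLinearMap.toLinearMap_smul, map_smul, trace_eq_sum_coord]
    simp [crossCLM_apply, cross, cross_apply, Fin.sum_univ_three]
  have hΔL : ∀ z, (Δ (⇑L)) z = 0 := fun z => by
    rw [laplacian_eq_sum_fderiv_fderiv (EuclideanSpace.basisFun (Fin 3) ℝ) L.contDiff z]
    simp [ContinuousLinearMap.fderiv]
  have hUd : ∀ z, DifferentiableAt ℝ U z := fun z => (hU2.differentiable (by norm_num)) z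
  have hW2 : ContDiff ℝ 2 (U - ⇑L) := hU2.sub L.contDiff
  have hcurlW : ∀ z, curl (U - ⇑L) z = 0 := fun z => by
    show curl (fun w => U w - L w) z = 0
    rw [curl_sub (hUd z) L.differentiableAt, hω z, hcurlL z, sub_self]
  have hdivW : VectorCalculus.IsDivFree (U - ⇑L) := fun z => by
    have h1 := hdiv z
    have h2 := hdivL z
    rw [VectorCalculus.divergence] at h1 h2 ⊢
    rw [fderiv_sub (hUd z) L.differentiableAt, ContinuousLinearMap.toLinearMap_sub, map_sub, h1,
      h2, sub_zero]
  have hΔW : ∀ z, (Δ (U - ⇑L)) z = 0 :=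
    laplacian_eq_zero_of_curl_eq_zero_of_isDivFree hW2 hcurlW hdivW
  have hΔU : ∀ z, (Δ U) z = 0 := fun z => by
    have e : U = (U - ⇑L) + ⇑L := by funext w; simp
    rw [e, (hW2.contDiffAt).laplacian_add (L.contDiff.contDiffAt), hΔW z, hΔL z, add_zero]
  exact liouville hU2 hΔU hM y 0

end VelocityOnlyAnsatz

/-! ### Bridge to the tree's classical-solution predicate -/

section ClassicalBridge

variable {γ T ν δ r : ℝ}
  {U : EuclideanSpace ℝ (Fin 3) → EuclideanSpace ℝ (Fin 3)}
  {u : ℝ → EuclideanSpace ℝ (Fin 3) → EuclideanSpace ℝ (Fin 3)} {p : ℝ → EuclideanSpace ℝ (Fin 3) → ℝ}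

/-- **Census form on the tree's solution class.** Let `(u, p)` be a classical (unforced)
Navier–Stokes solution on the time interval `(T−δ, T)` in the tree's sense
(`IsClassicalNSSolutionOn (Ioo (T−δ) T) ν 0 u p`), `ν ≠ 0`, whose VELOCITY coincides with the
power-law self-similar ansatz on a parabolic neighbourhood of the singular point,
`u(t, x) = (T−t)^{γ−1} U((T−t)^{−γ} x)` for `T−δ < t < T`, `‖x‖ < r` (`γ > 0`, `γ ≠ ½`; the
pressure is the solution's own, no ansatz), with a `C³`, divergence-free, bounded profile of
bounded vorticity. Then the profile is constant: `U(y) = U(0)` — the ansatz is a spatially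
constant field near the singular point (SELFSIM-NOGO (M1)/(M16-L)). [folklore] -/
theorem profile_eq_const_of_isClassicalNSSolutionOn (hγ0 : 0 < γ) (hγ : γ ≠ 1 / 2) (hν : ν ≠ 0)
    (hδ : 0 < δ) (hr : 0 < r)
    (hsol : IsClassicalNSSolutionOn (Ioo (T - δ) T) ν 0 u p)
    (hagree : ∀ t ∈ Ioo (T - δ) T, ∀ x ∈ ball (0 : EuclideanSpace ℝ (Fin 3)) r,
      u t x = selfSimilarCollapse γ T U t x)
    (hU : ContDiff ℝ 3 U) (hdiv : VectorCalculus.IsDivFree U)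
    {M : ℝ} (hM : ∀ y, ‖U y‖ ≤ M) {Mω : ℝ} (hMω : ∀ y, ‖curl U y‖ ≤ Mω)
    (y : EuclideanSpace ℝ (Fin 3)) : U y = U 0 := by
  refine profile_eq_const_of_ns_selfSimilar_velocity (T := T) (p := p) hγ0 hγ hν hδ hr hU hdiv hM hMω
    (fun t ht => (hsol.contDiff_pressure ht).of_le (by norm_cast)) ?_ y
  intro t ht x hx
  -- the solution agrees with the ansatz near (t, x): transfer every term of the momentum equation
  have hsp : u t =ᶠ[𝓝 x] selfSimilarCollapse γ T U t := by
    filter_upwards [isOpen_ball.mem_nhds hx] with z hz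
    exact hagree t ht z hz
  have htm : (fun s => u s x) =ᶠ[𝓝 t] fun s => selfSimilarCollapse γ T U s x := by
    filter_upwards [isOpen_Ioo.mem_nhds ht] with s hs
    exact hagree s hs x hx
  have hmom := hsol.momentum t ht x
  have h1 : timeDerivWithin (Ioo (T - δ) T) u t x = timeDeriv (selfSimilarCollapse γ T U) t x := by
    rw [timeDerivWithin, timeDeriv, derivWithin_of_isOpen isOpen_Ioo ht, htm.deriv_eq]
  have h2 : convect (u t) (u t) x =
      convect (selfSimilarCollapse γ T U t) (selfSimilarCollapse γ T U t) x := by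
    rw [convect, convect, hsp.fderiv_eq, hagree t ht x hx]
  have h3 : (Δ (u t)) x = (Δ (selfSimilarCollapse γ T U t)) x := (laplacian_congr_nhds hsp).eq_of_nhds
  rw [h1, h2, h3] at hmom
  rw [hmom]
  simp

/-- **No singularity is left.** Under the hypotheses of `profile_eq_const_of_isClassicalNSSolutionOn`,
if moreover `γ < 1` (the velocity scale `(T−t)^{γ−1}` diverges) and the solution's velocity stays
bounded at ONE point `x₀` of the ball as `t ↑ T` (`‖u(t, x₀)‖ ≤ C` on `(T−δ, T)` — e.g. any point of
`B(0,r) ∖ B̄(0,r/2)` under the census hypothesis (M1) «u bounded off `B_{r/2}`»), then the profile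
VANISHES: `U ≡ 0`, i.e. `u ≡ 0` on the parabolic neighbourhood — the point `(0, T)` carries no
self-similar singularity of this type. [folklore] -/
theorem profile_eq_zero_of_isClassicalNSSolutionOn (hγ0 : 0 < γ) (hγ : γ ≠ 1 / 2) (hγ1 : γ < 1)
    (hν : ν ≠ 0) (hδ : 0 < δ) (hr : 0 < r)
    (hsol : IsClassicalNSSolutionOn (Ioo (T - δ) T) ν 0 u p)
    (hagree : ∀ t ∈ Ioo (T - δ) T, ∀ x ∈ ball (0 : EuclideanSpace ℝ (Fin 3)) r,
      u t x = selfSimilarCollapse γ T U t x)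
    (hU : ContDiff ℝ 3 U) (hdiv : VectorCalculus.IsDivFree U)
    {M : ℝ} (hM : ∀ y, ‖U y‖ ≤ M) {Mω : ℝ} (hMω : ∀ y, ‖curl U y‖ ≤ Mω)
    {x₀ : EuclideanSpace ℝ (Fin 3)} (hx₀ : x₀ ∈ ball (0 : EuclideanSpace ℝ (Fin 3)) r) {C : ℝ}
    (hbdd : ∀ t ∈ Ioo (T - δ) T, ‖u t x₀‖ ≤ C) (y : EuclideanSpace ℝ (Fin 3)) : U y = 0 := by
  have hconst : ∀ z, U z = U 0 := fun z =>
    profile_eq_const_of_isClassicalNSSolutionOn (T := T) (p := p) hγ0 hγ hν hδ hr hsol hagree hU hdiv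
      hM hMω z
  rw [hconst y]
  by_contra hne
  have hpos : 0 < ‖U 0‖ := norm_pos_iff.mpr hne
  -- (T - t)^(γ-1) ‖U 0‖ → ∞ as t ↑ T
  have h1 : Tendsto (fun t : ℝ => T - t) (𝓝[<] T) (𝓝[>] 0) := by
    refine tendsto_nhdsWithin_of_tendsto_nhds_of_eventually_within _ ?_ ?_
    · have : Tendsto (fun t : ℝ => T - t) (𝓝 T) (𝓝 (T - T)) :=
        (continuous_const.sub continuous_id).tendsto T
      rw [sub_self] at this
      exact this.mono_left nhdsWithin_le_nhds
    · filter_upwards [self_mem_nhdsWithin] with t ht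
      exact sub_pos.mpr (Set.mem_Iio.mp ht)
  have hlim : Tendsto (fun t : ℝ => (T - t) ^ (γ - 1) * ‖U 0‖) (𝓝[<] T) atTop :=
    ((tendsto_rpow_neg_nhdsGT_zero (y := γ - 1) (by linarith)).comp h1).atTop_mul_const hpos
  have hI : ∀ᶠ t in 𝓝[<] T, t ∈ Ioo (T - δ) T := Ioo_mem_nhdsLT (sub_lt_self T hδ)
  obtain ⟨t, htC, htI⟩ := ((hlim.eventually_gt_atTop C).and hI).exists
  have ht : t < T := htI.2
  have hnorm : ‖u t x₀‖ = (T - t) ^ (γ - 1) * ‖U 0‖ := by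
    rw [hagree t htI x₀ hx₀, norm_selfSimilarCollapse ht, hconst ((T - t) ^ (-γ) • x₀)]
  exact absurd (hbdd t htI) (by rw [hnorm]; exact not_le.mpr htC)

end ClassicalBridge

end Summit.NavierStokesRegularity.FluidComputer.SelfSimilarCensus

end
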